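import Mathlib.Analysis.SpecialFunctions.Integrals.Basic
import Mathlib.Analysis.SpecialFunctions.Integrability.Basic
import Mathlib.MeasureTheory.Integral.Pi
import Mathlib.Tactic.Positivity
import Mathlib.Tactic.FieldSimp
import Mathlib.Tactic.Linarith
import HarnessLib

/-!
# Volkov's importance-sampling variance example (PRD 96, 096018 (2017) §III.A, eq. (eq_ab_disp)) — PROVED: for f = Π a_j x_j^{a_j−1}, g = Π b_j x_j^{b_j−1} on the unit cube, V(f,g) = Π_j a_j²/(b_j(2a_j − b_j)) − 1 when 0 < b_j < 2a_j, and the second moment is infinite as soon as b ≥ 2a in one coordinate ("case 3")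

independent recomputation; certified where stated, statistical where stated; no new-physics claim.

CITATION HEADER (venture `QEDPrecision`, cell `pub-qed`; literature seat gen 21; VALUE-FREE: a textbook computation printed in the source,
no Monte-Carlo value, nothing per graph or family). This is the printed toy model behind the sentence "The numbers Deg({j_l,…,j_n}) play the
same role in the sector S_{j₁,…,j_n} as b₁,…,b_n play in (eq_density_bb). Thus, adjusting Deg(s) requires a lot of care" (PRD 96 §III.B,
tex l.602–605) — i.e. the mechanism by which an under-estimated sector exponent gives an INFINITE variance; the IR/SE lane (`irse/SEATS.md`
rule 4, strand (c)) and `pub-qed-int-2/TAILS.md` argue about exactly this mechanism. Companion of `Volkov2017.SamplingDegree` (Deg(s)).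
Source: [Volkov2017] S. Volkov, Phys. Rev. D 96, 096018 (2017) = arXiv:1705.05800v2, §III.A "Importance Sampling" (LaTeX e-print held by
the cell, HOME `data/lit/sources/.cache/1705.05800/amm4_mc_arxiv.tex`, l.489–559). VERBATIM: "The standard deviation of this value is
(eq_sigma) σ = √(V(f,g)/N), where V(f,g) = ∫_Ω f(x)²/g(x) dx − (∫_Ω f(x) dx)², see [mc_james]." (l.501–511) · "3. V(f,g) is infinite. In this
case, we will have unstable convergence that is slower than C/√N. An adequate error estimation is difficult in this case." (l.530–533) ·
"Selection of the function g(x) needs a lot of care. For example, let Ω = [0;1]ⁿ, f(x₁,…,x_n) = a₁…a_n x₁^{a₁−1}…x_n^{a_n−1},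
(eq_density_bb) g(x₁,…,x_n) = b₁…b_n x₁^{b₁−1}…x_n^{b_n−1}, a₁,…,a_n,b₁,…,b_n > 0. In this case, (eq_ab_disp)
V(f,g) = a₁²…a_n² / (b₁…b_n (2a₁−b₁)…(2a_n−b_n)) − 1. On the one hand, if there exists j such that b_j > 2a_j, then we fall into case 3. On the
other hand, if we take some small value for all b_j, then the value (eq_ab_disp) can be very big due to the factor 1/(b₁…b_n) when n is
large." (l.541–559).

What is typed and proved: `fToy a x = a·x^{a−1}`, `gToy b x = b·x^{b−1}` (one coordinate); `fToy_integral`: ∫₀¹ a x^{a−1} dx = 1 (a > 0);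
`sq_div_toy_eq`: f²/g = (a²/b)·x^{2a−b−1} for x > 0; **`secondMoment_toy`: ∫₀¹ f²/g dx = a²/(b(2a − b)) for 0 < b < 2a**;
**`secondMoment_toy_not_integrable`: f²/g is NOT integrable on (0,1) when b ≥ 2a** (the printed "b_j > 2a_j ⇒ case 3", boundary included);
the unit cube Ω = (0,1]ⁿ as the product measure `cube n`, the product integrands `fToyN`, `gToyN`, V as printed (`vOf`), and
**`eq_ab_disp`: V(f,g) = Π_j a_j²/(b_j(2a_j − b_j)) − 1** for 0 < b_j < 2a_j (Fubini via `MeasureTheory.integral_fin_nat_prod_eq_prod`).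
NOT typed: the Monte-Carlo CLT statement (eq_sigma) itself (a definition of σ in the source), nor anything about Volkov's actual densities.
-/

namespace Literature.MathematicalPhysics.QuantumFieldTheory.Volkov2017

open Real MeasureTheory Set

noncomputable section

/-! ## One coordinate -/

/-- One factor of the printed f: `a·x^{a−1}`. [cite: Volkov2017, §III.A (l.541–545)] -/
def fToy (a x : ℝ) : ℝ := a * x ^ (a - 1)

/-- One factor of the printed g (eq_density_bb): `b·x^{b−1}`. [cite: Volkov2017, §III.A (eq_density_bb, l.546–548)] -/
def gToy (b x : ℝ) : ℝ := b * x ^ (b - 1)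

/-- ∫₀¹ a·x^{a−1} dx = 1 for a > 0 (so f and g are normalised and (∫_Ω f)² = 1 in (eq_ab_disp)). [cite: Volkov2017, §III.A (l.541–549)] -/
theorem fToy_integral (a : ℝ) (ha : 0 < a) : ∫ x in (0 : ℝ)..1, fToy a x = 1 := by
  unfold fToy
  rw [intervalIntegral.integral_const_mul, integral_rpow (Or.inl (by linarith))]
  have h1 : a - 1 + 1 = a := by ring
  rw [h1, Real.one_rpow, Real.zero_rpow ha.ne', sub_zero]
  field_simp

/-- Pointwise: f²/g = (a²/b)·x^{2a−b−1} for x > 0. [cite: Volkov2017, §III.A (eq_ab_disp)] -/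
theorem sq_div_toy_eq (a b x : ℝ) (hx : 0 < x) (hb : b ≠ 0) :
    fToy a x ^ 2 / gToy b x = a ^ 2 / b * x ^ (2 * a - b - 1) := by
  unfold fToy gToy
  have hq : x ^ (b - 1) ≠ 0 := (Real.rpow_pos_of_pos hx _).ne'
  have hsq : (x ^ (a - 1)) ^ 2 = x ^ ((a - 1) * 2) := by
    rw [Real.rpow_mul hx.le]; norm_num
  have hsub : x ^ (2 * a - b - 1) = x ^ ((a - 1) * 2) / x ^ (b - 1) := by
    rw [← Real.rpow_sub hx]; ring_nf
  rw [mul_pow, hsq, hsub]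
  field_simp

/-- **(eq_ab_disp), one coordinate**: ∫₀¹ (a x^{a−1})²/(b x^{b−1}) dx = a²/(b(2a − b)) for 0 < b < 2a. [cite: Volkov2017, §III.A (eq_ab_disp, l.549–553)] -/
theorem secondMoment_toy (a b : ℝ) (hb : 0 < b) (h : b < 2 * a) :
    ∫ x in (0 : ℝ)..1, fToy a x ^ 2 / gToy b x = a ^ 2 / (b * (2 * a - b)) := by
  have hcongr : ∫ x in (0 : ℝ)..1, fToy a x ^ 2 / gToy b x = ∫ x in (0 : ℝ)..1, a ^ 2 / b * x ^ (2 * a - b - 1) := by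
    apply intervalIntegral.integral_congr_ae
    filter_upwards with x hx
    rw [Set.uIoc_of_le zero_le_one] at hx
    exact sq_div_toy_eq a b x hx.1 hb.ne'
  rw [hcongr, intervalIntegral.integral_const_mul, integral_rpow (Or.inl (by linarith))]
  have h2 : 2 * a - b - 1 + 1 = 2 * a - b := by ring
  rw [h2, Real.one_rpow, Real.zero_rpow (by linarith : 2 * a - b ≠ 0), sub_zero]
  rw [div_mul_div_comm, mul_one]

/-- **"if there exists j such that b_j > 2a_j, then we fall into case 3"** (V infinite), one coordinate and with the boundary: for b ≥ 2a the
second-moment integrand (a x^{a−1})²/(b x^{b−1}) = (a²/b) x^{2a−b−1} is not integrable on (0, 1) (a ≠ 0, b > 0).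
[cite: Volkov2017, §III.A (l.554–555, case 3 l.530–533)] -/
theorem secondMoment_toy_not_integrable (a b : ℝ) (ha : a ≠ 0) (hb : 0 < b) (h : 2 * a ≤ b) :
    ¬ IntegrableOn (fun x => fToy a x ^ 2 / gToy b x) (Ioo 0 1) := by
  intro hint
  have hc : a ^ 2 / b ≠ 0 := by positivity
  have hint' : IntegrableOn (fun x : ℝ => a ^ 2 / b * x ^ (2 * a - b - 1)) (Ioo 0 1) :=
    hint.congr_fun (fun x hx => sq_div_toy_eq a b x hx.1 hb.ne') measurableSet_Ioo
  have hpow : IntegrableOn (fun x : ℝ => x ^ (2 * a - b - 1)) (Ioo 0 1) := by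
    have hm : IntegrableOn (fun x : ℝ => (a ^ 2 / b)⁻¹ * (a ^ 2 / b * x ^ (2 * a - b - 1))) (Ioo 0 1) :=
      Integrable.const_mul hint' _
    refine IntegrableOn.congr_fun hm (fun x _ => ?_) measurableSet_Ioo
    field_simp
  rw [intervalIntegral.integrableOn_Ioo_rpow_iff one_pos] at hpow
  linarith

/-! ## The unit cube and (eq_ab_disp) in n coordinates -/

/-- Ω = (0, 1]ⁿ with Lebesgue measure, as the product of n copies of Lebesgue measure restricted to (0, 1]. [cite: Volkov2017, §III.A ("let Ω = [0;1]ⁿ")] -/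
def cube (n : ℕ) : Measure (Fin n → ℝ) := Measure.pi fun _ => (volume : Measure ℝ).restrict (Ioc 0 1)

/-- "f(x₁,…,x_n) = a₁…a_n x₁^{a₁−1}…x_n^{a_n−1}" = Π_j a_j x_j^{a_j−1}. [cite: Volkov2017, §III.A (l.543–545)] -/
def fToyN {n : ℕ} (a : Fin n → ℝ) (x : Fin n → ℝ) : ℝ := ∏ j, fToy (a j) (x j)

/-- "(eq_density_bb) g(x₁,…,x_n) = b₁…b_n x₁^{b₁−1}…x_n^{b_n−1}" = Π_j b_j x_j^{b_j−1}. [cite: Volkov2017, §III.A (eq_density_bb)] -/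
def gToyN {n : ℕ} (b : Fin n → ℝ) (x : Fin n → ℝ) : ℝ := ∏ j, gToy (b j) (x j)

/-- "V(f,g) = ∫_Ω f(x)²/g(x) dx − (∫_Ω f(x) dx)²". [cite: Volkov2017, §III.A (l.505–511)] -/
def vOf (n : ℕ) (f g : (Fin n → ℝ) → ℝ) : ℝ := (∫ x, f x ^ 2 / g x ∂(cube n)) - (∫ x, f x ∂(cube n)) ^ 2

/-- ∫_Ω f = 1 (each factor integrates to 1). [cite: Volkov2017, §III.A (l.541–549)] -/
theorem fToyN_integral {n : ℕ} (a : Fin n → ℝ) (ha : ∀ j, 0 < a j) : ∫ x, fToyN a x ∂(cube n) = 1 := by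
  have hprod : (∫ x, fToyN a x ∂(cube n)) = ∏ j, ∫ x, fToy (a j) x ∂((volume : Measure ℝ).restrict (Ioc 0 1)) :=
    MeasureTheory.integral_fin_nat_prod_eq_prod (fun j x => fToy (a j) x)
  rw [hprod]
  refine Finset.prod_eq_one fun j _ => ?_
  rw [← intervalIntegral.integral_of_le zero_le_one]
  exact fToy_integral (a j) (ha j)

/-- ∫_Ω f²/g = Π_j a_j²/(b_j(2a_j − b_j)) for 0 < b_j < 2a_j. [cite: Volkov2017, §III.A (eq_ab_disp)] -/
theorem fToyN_secondMoment {n : ℕ} (a b : Fin n → ℝ) (hb : ∀ j, 0 < b j) (h : ∀ j, b j < 2 * a j) :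
    ∫ x, fToyN a x ^ 2 / gToyN b x ∂(cube n) = ∏ j, a j ^ 2 / (b j * (2 * a j - b j)) := by
  have hpt : (fun x => fToyN a x ^ 2 / gToyN b x) = fun x => ∏ j, (fToy (a j) (x j) ^ 2 / gToy (b j) (x j)) := by
    funext x; unfold fToyN gToyN; rw [Finset.prod_div_distrib, Finset.prod_pow]
  have hprod : (∫ x, (fun x => ∏ j, (fToy (a j) (x j) ^ 2 / gToy (b j) (x j))) x ∂(cube n)) =
      ∏ j, ∫ x, fToy (a j) x ^ 2 / gToy (b j) x ∂((volume : Measure ℝ).restrict (Ioc 0 1)) :=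
    MeasureTheory.integral_fin_nat_prod_eq_prod (fun j x => fToy (a j) x ^ 2 / gToy (b j) x)
  rw [hpt, hprod]
  refine Finset.prod_congr rfl fun j _ => ?_
  rw [← intervalIntegral.integral_of_le zero_le_one]
  exact secondMoment_toy (a j) (b j) (hb j) (h j)

/-- **(eq_ab_disp)**: "V(f,g) = a₁²…a_n² / (b₁…b_n (2a₁−b₁)…(2a_n−b_n)) − 1" for a_j, b_j > 0 with b_j < 2a_j.
[cite: Volkov2017, §III.A (eq_ab_disp, l.549–553)] -/
theorem eq_ab_disp {n : ℕ} (a b : Fin n → ℝ) (ha : ∀ j, 0 < a j) (hb : ∀ j, 0 < b j) (h : ∀ j, b j < 2 * a j) :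
    vOf n (fToyN a) (gToyN b) = (∏ j, a j ^ 2 / (b j * (2 * a j - b j))) - 1 := by
  unfold vOf
  rw [fToyN_integral a ha, fToyN_secondMoment a b hb h]
  ring


/-! ### Elementary consequence of (eq_ab_disp): every factor is ≥ 1, with equality exactly at `b_j = a_j`

Volkov prints the two failure modes ("if there exists j such that b_j > 2a_j, then we fall into case 3. On the other hand, if we
take some small value for all b_j, then the value (eq_ab_disp) can be very big due to the factor 1/(b₁…b_n) when n is large",
§III.A l.554–558). The following elementary facts about the printed formula locate its optimum: since
`b(2a − b) = a² − (a − b)²`, each factor satisfies `a²/(b(2a − b)) ≥ 1` for `0 < b < 2a`, with equality iff `b = a`; hence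
`V(f,g) ≥ 0`, and `V(f,g) = 0` when `b_j = a_j` for all `j` (then `g = f`). (Recorded for the IR/SE lane's per-level design check
"price Π_l a_l²/(b_l(2a_l − b_l)), minimal at b_l = a_l" — `pub-qed-int-2/irse-input/TAIL-LAW-int2.md` §8.4; VALUE-FREE.) -/

/-- Each factor of (eq_ab_disp) is at least `1`: `a²/(b(2a − b)) ≥ 1` for `0 < b < 2a` (because `b(2a − b) = a² − (a − b)² ≤ a²`).
Elementary consequence of the printed formula. [cite: Volkov2017, §III.A (eq_ab_disp, l.549–558)] -/
theorem toyFactor_one_le (a b : ℝ) (hb : 0 < b) (h : b < 2 * a) : 1 ≤ a ^ 2 / (b * (2 * a - b)) := by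
  rw [le_div_iff₀ (mul_pos hb (by linarith)), one_mul]
  nlinarith [sq_nonneg (a - b)]

/-- … with equality exactly when `b = a`. Elementary consequence of the printed formula.
[cite: Volkov2017, §III.A (eq_ab_disp, l.549–558)] -/
theorem toyFactor_eq_one_iff (a b : ℝ) (hb : 0 < b) (h : b < 2 * a) : a ^ 2 / (b * (2 * a - b)) = 1 ↔ b = a := by
  have hden : 0 < b * (2 * a - b) := mul_pos hb (by linarith)
  rw [div_eq_one_iff_eq hden.ne']
  constructor
  · intro heq
    have : (a - b) ^ 2 = 0 := by nlinarith [heq]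
    have hab : a - b = 0 := pow_eq_zero_iff (n := 2) (by norm_num) |>.mp this
    linarith
  · rintro rfl; ring

/-- Hence the printed dispersion is non-negative: `V(f,g) = Π_j a_j²/(b_j(2a_j − b_j)) − 1 ≥ 0` for `0 < b_j < 2a_j`.
Elementary consequence of the printed formula. [cite: Volkov2017, §III.A (eq_ab_disp, l.549–558)] -/
theorem eq_ab_disp_nonneg {n : ℕ} (a b : Fin n → ℝ) (ha : ∀ j, 0 < a j) (hb : ∀ j, 0 < b j) (h : ∀ j, b j < 2 * a j) :
    0 ≤ vOf n (fToyN a) (gToyN b) := by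
  rw [eq_ab_disp a b ha hb h, sub_nonneg]
  exact Finset.prod_induction _ (fun x => 1 ≤ x) (fun x y hx hy => one_le_mul_of_one_le_of_one_le hx hy) le_rfl
    (fun j _ => toyFactor_one_le (a j) (b j) (hb j) (h j))

/-- … and vanishes at `b = a` (then `g = f`: sampling from the integrand itself): `V(f,f) = 0`.
Elementary consequence of the printed formula. [cite: Volkov2017, §III.A (eq_ab_disp, l.549–558)] -/
theorem eq_ab_disp_self {n : ℕ} (a : Fin n → ℝ) (ha : ∀ j, 0 < a j) : vOf n (fToyN a) (gToyN a) = 0 := by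
  rw [eq_ab_disp a a ha ha (fun j => by linarith [ha j]), sub_eq_zero]
  exact Finset.prod_eq_one fun j _ => (toyFactor_eq_one_iff (a j) (a j) (ha j) (by linarith [ha j])).mpr rfl



/-! ### The weight `f/g` under the density `g`: the printed three cases decided for the printed model, and its exact Pareto law

In the printed model the importance weight is `w(x) = f(x)/g(x) = (a/b)·x^{a−b}` (one coordinate, `x ∈ (0,1]`, density `g = b·x^{b−1}`).
The following are ELEMENTARY CONSEQUENCES of the printed objects (eq_density_bb)/(eq_ab_disp), proved here — ⟦lit⟧ corollaries: the
source prints the three-case classification (§III.A l.519–533: "1. The function f/g is bounded … 2. The function f/g is unbounded, but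
V(f,g) is finite … 3. V(f,g) is infinite. In this case, we will have unstable convergence that is slower than C/√N") and the criterion
"if there exists j such that b_j > 2a_j, then we fall into case 3" (l.554–555), not the formulas below.
* CASE 1 decided: for `b ≤ a` the weight is bounded, `w ≤ a/b` on `(0,1]` (`weight_toy_le`); for `b > a` it exceeds every level
  `t ≥ a/b` exactly on the interval `(0, s_t)`, `s_t = (a/(bt))^{1/(b−a)} ∈ (0,1]` (`lt_weight_toy_iff`, `superlevel_eq_Ioo`), so it is
  unbounded (cases 2/3).
* THE LAW OF THE WEIGHT (case `b > a`): `P_g(x ≤ s) = ∫₀^s g = s^b` (`gToy_integral`, the sampler's depth law) and hence, for `t ≥ a/b`,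
  `P_g(w > t) = ∫₀^{s_t} g = (a/(bt))^{b/(b−a)} = ((a/b)/t)^α` (`gToy_integral_tailPoint`, `gToy_integral_tailPoint'`): under `g` the
  weight is EXACTLY Pareto with scale `a/b` and TAIL INDEX `α = b/(b − a)` (written out as `b / (b - a)` in every statement; no new
  definition is introduced by this section); `α > 1` always (`one_lt_tailIndex`);
  `k < α ↔ (k−1)b < ka` (`lt_tailIndex_iff`), in particular `2 < α ↔ b < 2a` (`two_lt_tailIndex_iff`) — the printed finite-variance
  criterion of (eq_ab_disp) read as a tail index; the k-th moment `E_g w^k = ∫₀¹ (f/g)^k g = a^k/(b^{k−1}(ka − (k−1)b))` for `(k−1)b < ka`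
  (`moment_toy`; k = 2 is (eq_ab_disp)'s factor) and `(f/g)^k g` NOT integrable on (0,1) for `ka ≤ (k−1)b` (`moment_toy_not_integrable`):
  the k-th moment is finite iff `k < α`.
* TRUNCATED SECOND MOMENT: `∫_ε^1 f²/g = a²/(b(2a−b))·(1 − ε^{2a−b})` for `b ≠ 2a`, `0 < ε ≤ 1` (`truncSecondMoment_toy`) — in case 3
  (`b > 2a`) this is `a²/(b(b−2a))·(ε^{−(b−2a)} − 1)`, unbounded as `ε → 0` — and the exponent identity `(b − 2a)/b = 2/α − 1`
  (`growthExponent_eq`, `depthCut_rpow`: `(N^{−1/b})^{−(b−2a)} = N^{2/α−1}`).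
These are the objects of the IR/SE lane's per-face TAIL LAW under the dictionary `(a, D) ↔ (a, b)`: "weight y = H/g ~ t^{(a−D)}: BOUNDED at
the face iff D(S) ≤ a(S); else a Pareto tail with index α(S) = D(S)/(D(S) − a(S)) (finite variance there iff D(S) < 2a(S))"
(`pub-qed-int-2/irse-input/TAIL-LAW-int2.md` §1; the same statements are `irse/B-SAMPLER-DESIGN.md` (I2′)/(I3′) "BOUNDED along g iff
D_g ≤ m₁(g), FINITE VARIANCE iff D_g < 2·m₁(g), tail index α_g = D_g/(D_g − m₁(g))", and `irse/VARIANCE-DIAGNOSTICS.md` §1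
"g_implied = 1/α̂(q_deep) − 1/2") — in the printed one-exponent model they are theorems. The READING "at N samples the realised sum is cut
at depth ε_N with ε_N^b = 1/N, so σ·√N grows like (ε_N^{−(b−2a)})^{1/2} = N^{1/α − 1/2}" is the cell's heuristic (setv-gen-06
SIGMA-MODEL §10 (2)), NOT a printed statement and NOT proved here; only the closed forms it combines are. VALUE-FREE (literature seat
gen 23; no Monte-Carlo value, nothing per graph or family). -/

/-- The importance weight of the printed model: `f/g = (a/b)·x^{a−b}` for `x > 0`, `b ≠ 0`.
Elementary consequence of the printed f and g. [cite: Volkov2017, §III.A (eq_density_bb, l.541–548)] -/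
theorem weight_toy_eq (a b x : ℝ) (hx : 0 < x) (hb : b ≠ 0) :
    fToy a x / gToy b x = a / b * x ^ (a - b) := by
  unfold fToy gToy
  have hq : x ^ (b - 1) ≠ 0 := (Real.rpow_pos_of_pos hx _).ne'
  have hsub : x ^ (a - b) = x ^ (a - 1) / x ^ (b - 1) := by
    rw [← Real.rpow_sub hx]; ring_nf
  rw [hsub]
  field_simp

/-- **Case 1 ("the function f/g is bounded") holds for `b ≤ a`**: `f/g ≤ a/b` on `(0,1]`.
Elementary consequence of the printed f and g. [cite: Volkov2017, §III.A (case 1 l.519–523; eq_density_bb)] -/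
theorem weight_toy_le (a b x : ℝ) (hb : 0 < b) (hba : b ≤ a) (hx0 : 0 < x) (hx1 : x ≤ 1) :
    fToy a x / gToy b x ≤ a / b := by
  rw [weight_toy_eq a b x hx0 hb.ne']
  have h1 : x ^ (a - b) ≤ 1 := Real.rpow_le_one hx0.le hx1 (sub_nonneg.mpr hba)
  have hab : 0 ≤ a / b := div_nonneg (hb.le.trans hba) hb.le
  calc a / b * x ^ (a - b) ≤ a / b * 1 := mul_le_mul_of_nonneg_left h1 hab
    _ = a / b := mul_one _

/-- The sampler's depth law in the printed model: `∫₀^s b·x^{b−1} dx = s^b` (`b > 0`; meaningful for `s ≥ 0`, where it is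
`P_g(x ≤ s)`; Lean's `rpow`/interval-integral conventions make the identity hold for every real `s`).
Elementary consequence of the printed g. [cite: Volkov2017, §III.A (eq_density_bb)] -/
theorem gToy_integral (b s : ℝ) (hb : 0 < b) : ∫ x in (0 : ℝ)..s, gToy b x = s ^ b := by
  unfold gToy
  rw [intervalIntegral.integral_const_mul, integral_rpow (Or.inl (by linarith))]
  have h1 : b - 1 + 1 = b := by ring
  rw [h1, Real.zero_rpow hb.ne', sub_zero]
  field_simp

/-- The point below which the weight exceeds the level `t` (case `b > a`) is `s_t := (a/(b·t))^{1/(b−a)}` (written out in every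
statement below; no new definition). `s_t > 0`. Elementary. [cite: Volkov2017, §III.A (eq_density_bb)] -/
theorem tailPoint_pos {a b t : ℝ} (ha : 0 < a) (hb : 0 < b) (ht : 0 < t) : 0 < (a / (b * t)) ^ (1 / (b - a)) :=
  Real.rpow_pos_of_pos (by positivity) _

/-- `s_t ≤ 1` exactly from the minimal weight on: `t ≥ a/b` (the weight's value at `x = 1`). Elementary consequence of the printed
f and g. [cite: Volkov2017, §III.A (eq_density_bb)] -/
theorem tailPoint_le_one {a b t : ℝ} (ha : 0 < a) (hb : 0 < b) (hab : a < b) (ht : a / b ≤ t) : (a / (b * t)) ^ (1 / (b - a)) ≤ 1 := by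
  have htpos : 0 < t := lt_of_lt_of_le (div_pos ha hb) ht
  have hle : a / (b * t) ≤ 1 := by
    rw [div_le_one (by positivity)]
    rwa [div_le_iff₀ hb, mul_comm] at ht
  exact Real.rpow_le_one (by positivity) hle (by rw [one_div, inv_nonneg]; linarith)

/-- **Cases 2/3 located**: for `b > a`, `t > 0`, `x > 0` the weight exceeds `t` iff `x < s_t` (the weight `(a/b)x^{a−b}` is strictly
decreasing; it is unbounded near `x = 0`). Elementary consequence of the printed f and g. [cite: Volkov2017, §III.A (cases 2–3 l.524–533; eq_density_bb)] -/
theorem lt_weight_toy_iff {a b t x : ℝ} (ha : 0 < a) (hab : a < b) (ht : 0 < t) (hx : 0 < x) :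
    t < fToy a x / gToy b x ↔ x < (a / (b * t)) ^ (1 / (b - a)) := by
  have hb : 0 < b := ha.trans hab
  have hc : 0 < b - a := sub_pos.mpr hab
  rw [weight_toy_eq a b x hx hb.ne']
  have hneg : x ^ (a - b) = (x ^ (b - a))⁻¹ := by
    rw [← Real.rpow_neg hx.le]; ring_nf
  have hxp : 0 < x ^ (b - a) := Real.rpow_pos_of_pos hx _
  rw [hneg, one_div, Real.lt_rpow_inv_iff_of_pos hx.le (by positivity) hc, ← div_eq_mul_inv, lt_div_iff₀ hxp,
    lt_div_iff₀ (by positivity : (0:ℝ) < b * t), lt_div_iff₀ hb]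
  constructor <;> intro h <;> nlinarith [h]

/-- The super-level set of the weight inside Ω = (0,1]: `{x ∈ (0,1] : f/g > t} = (0, s_t)` for `t ≥ a/b` (case `b > a`).
Elementary consequence of the printed f and g. [cite: Volkov2017, §III.A (eq_density_bb)] -/
theorem superlevel_eq_Ioo {a b t : ℝ} (ha : 0 < a) (hab : a < b) (ht : a / b ≤ t) :
    {x : ℝ | x ∈ Ioc (0:ℝ) 1 ∧ t < fToy a x / gToy b x} = Ioo 0 ((a / (b * t)) ^ (1 / (b - a))) := by
  have hb : 0 < b := ha.trans hab
  have htpos : 0 < t := lt_of_lt_of_le (div_pos ha hb) ht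
  ext x
  simp only [Set.mem_setOf_eq, Set.mem_Ioc, Set.mem_Ioo]
  constructor
  · rintro ⟨⟨hx0, -⟩, hw⟩
    exact ⟨hx0, (lt_weight_toy_iff ha hab htpos hx0).mp hw⟩
  · rintro ⟨hx0, hxs⟩
    exact ⟨⟨hx0, hxs.le.trans (tailPoint_le_one ha hb hab ht)⟩, (lt_weight_toy_iff ha hab htpos hx0).mpr hxs⟩

/-- **The law of the weight**: for `b > a` and `t > 0`, `∫₀^{s_t} g = (a/(b·t))^{b/(b−a)}`; for `t ≥ a/b` (so that `(0, s_t) ⊆ Ω`,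
`superlevel_eq_Ioo`) this is `P_g(f/g > t)`. Elementary consequence of the printed f and g. [cite: Volkov2017, §III.A (eq_density_bb)] -/
theorem gToy_integral_tailPoint {a b t : ℝ} (ha : 0 < a) (hab : a < b) (ht : 0 < t) :
    ∫ x in (0 : ℝ)..(a / (b * t)) ^ (1 / (b - a)), gToy b x = (a / (b * t)) ^ (b / (b - a)) := by
  have hb : 0 < b := ha.trans hab
  rw [gToy_integral b _ hb, ← Real.rpow_mul (by positivity)]
  rw [div_mul_eq_mul_div, one_mul]

/-- … in Pareto form: `P_g(f/g > t) = ((a/b)/t)^α` with scale `a/b` (the minimal weight) and index `α = b/(b−a)`.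
Elementary consequence of the printed f and g. [cite: Volkov2017, §III.A (eq_density_bb)] -/
theorem gToy_integral_tailPoint' {a b t : ℝ} (ha : 0 < a) (hab : a < b) (ht : 0 < t) :
    ∫ x in (0 : ℝ)..(a / (b * t)) ^ (1 / (b - a)), gToy b x = ((a / b) / t) ^ (b / (b - a)) := by
  rw [gToy_integral_tailPoint ha hab ht, div_div]

/-- `α > 1` always (`a > 0`): the weight has a finite mean (it integrates f). [cite: Volkov2017, §III.A (eq_density_bb)] -/
theorem one_lt_tailIndex {a b : ℝ} (ha : 0 < a) (hab : a < b) : 1 < b / (b - a) := by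
  rw [one_lt_div (sub_pos.mpr hab)]
  linarith

/-- `k < α ↔ (k − 1)·b < k·a` (case `b > a`): the k-th-moment criterion (`moment_toy` / `moment_toy_not_integrable`) as a tail-index
inequality. [cite: Volkov2017, §III.A (eq_ab_disp)] -/
theorem lt_tailIndex_iff {a b : ℝ} (hab : a < b) (k : ℝ) : k < b / (b - a) ↔ (k - 1) * b < k * a := by
  rw [lt_div_iff₀ (sub_pos.mpr hab)]
  constructor <;> intro h <;> linarith

/-- **`2 < α ↔ b < 2a`**: the printed finite-variance criterion of (eq_ab_disp) ("if there exists j such that b_j > 2a_j, then we fall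
into case 3") says exactly that the weight's tail index exceeds 2. [cite: Volkov2017, §III.A (eq_ab_disp, l.549–555)] -/
theorem two_lt_tailIndex_iff {a b : ℝ} (hab : a < b) : 2 < b / (b - a) ↔ b < 2 * a := by
  rw [lt_tailIndex_iff hab]
  constructor <;> intro h <;> linarith

/-- Pointwise: `(f/g)^k · g = (a^k/b^{k−1})·x^{k(a−b)+(b−1)}` for `x > 0` (real `k`; `a, b > 0`).
Elementary consequence of the printed f and g. [cite: Volkov2017, §III.A (eq_density_bb)] -/
theorem weight_rpow_mul_gToy_eq {a b : ℝ} (ha : 0 < a) (hb : 0 < b) (k : ℝ) {x : ℝ} (hx : 0 < x) :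
    (fToy a x / gToy b x) ^ k * gToy b x = a ^ k / b ^ (k - 1) * x ^ (k * (a - b) + (b - 1)) := by
  rw [weight_toy_eq a b x hx hb.ne']
  unfold gToy
  rw [Real.mul_rpow (div_nonneg ha.le hb.le) (Real.rpow_nonneg hx.le _), Real.div_rpow ha.le hb.le,
    ← Real.rpow_mul hx.le, Real.rpow_add hx, Real.rpow_sub_one hb.ne']
  have hbk : b ^ k ≠ 0 := (Real.rpow_pos_of_pos hb k).ne'
  have e : (a - b) * k = k * (a - b) := mul_comm _ _
  rw [e]
  field_simp

/-- **k-th moment of the weight** (real `k`): `E_g (f/g)^k = ∫₀¹ (f/g)^k g dx = a^k/(b^{k−1}·(k·a − (k−1)·b))` when `(k−1)·b < k·a`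
(i.e. `k < α`, `lt_tailIndex_iff`); `k = 2` is (eq_ab_disp)'s factor `a²/(b(2a−b))` (`secondMoment_toy`).
Elementary consequence of the printed f and g. [cite: Volkov2017, §III.A (eq_ab_disp)] -/
theorem moment_toy {a b : ℝ} (ha : 0 < a) (hb : 0 < b) (k : ℝ) (hk : (k - 1) * b < k * a) :
    ∫ x in (0 : ℝ)..1, (fToy a x / gToy b x) ^ k * gToy b x = a ^ k / (b ^ (k - 1) * (k * a - (k - 1) * b)) := by
  have hcongr : ∫ x in (0 : ℝ)..1, (fToy a x / gToy b x) ^ k * gToy b x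
      = ∫ x in (0 : ℝ)..1, a ^ k / b ^ (k - 1) * x ^ (k * (a - b) + (b - 1)) := by
    apply intervalIntegral.integral_congr_ae
    filter_upwards with x hx
    rw [Set.uIoc_of_le zero_le_one] at hx
    exact weight_rpow_mul_gToy_eq ha hb k hx.1
  rw [hcongr, intervalIntegral.integral_const_mul, integral_rpow (Or.inl (by linarith))]
  have h2 : k * (a - b) + (b - 1) + 1 = k * a - (k - 1) * b := by ring
  rw [h2, Real.one_rpow, Real.zero_rpow (by linarith : k * a - (k - 1) * b ≠ 0), sub_zero]
  rw [div_mul_div_comm, mul_one]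

/-- … and for `k·a ≤ (k−1)·b` (i.e. `k ≥ α`) the k-th-moment integrand `(f/g)^k g` is NOT integrable on (0,1): the weight's k-th moment
is infinite — the printed "case 3" at `k = 2` (`secondMoment_toy_not_integrable`), and the general 'moment of order k finite iff k < α'
property of a Pareto law of index α. Elementary consequence of the printed f and g. [cite: Volkov2017, §III.A (eq_ab_disp, case 3 l.530–533)] -/
theorem moment_toy_not_integrable {a b : ℝ} (ha : 0 < a) (hb : 0 < b) (k : ℝ) (hk : k * a ≤ (k - 1) * b) :
    ¬ IntegrableOn (fun x => (fToy a x / gToy b x) ^ k * gToy b x) (Ioo 0 1) := by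
  intro hint
  have hc : a ^ k / b ^ (k - 1) ≠ 0 := (div_pos (Real.rpow_pos_of_pos ha k) (Real.rpow_pos_of_pos hb _)).ne'
  have hint' : IntegrableOn (fun x : ℝ => a ^ k / b ^ (k - 1) * x ^ (k * (a - b) + (b - 1))) (Ioo 0 1) :=
    hint.congr_fun (fun x hx => weight_rpow_mul_gToy_eq ha hb k hx.1) measurableSet_Ioo
  have hpow : IntegrableOn (fun x : ℝ => x ^ (k * (a - b) + (b - 1))) (Ioo 0 1) := by
    have hm : IntegrableOn
        (fun x : ℝ => (a ^ k / b ^ (k - 1))⁻¹ * (a ^ k / b ^ (k - 1) * x ^ (k * (a - b) + (b - 1)))) (Ioo 0 1) :=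
      Integrable.const_mul hint' _
    refine IntegrableOn.congr_fun hm (fun x _ => ?_) measurableSet_Ioo
    field_simp
  rw [intervalIntegral.integrableOn_Ioo_rpow_iff one_pos] at hpow
  linarith

/-- **Truncated second moment**: for `b ≠ 2a` and `0 < ε ≤ 1`, `∫_ε^1 f²/g dx = a²/(b(2a − b))·(1 − ε^{2a−b})`; in case 3 (`b > 2a`) this
equals `a²/(b(b − 2a))·(ε^{−(b−2a)} − 1)` and is unbounded as `ε → 0` (consistent with `secondMoment_toy_not_integrable`).
Elementary consequence of the printed f and g. [cite: Volkov2017, §III.A (eq_ab_disp)] -/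
theorem truncSecondMoment_toy (a b ε : ℝ) (hb : 0 < b) (h2 : b ≠ 2 * a) (hε : 0 < ε) (hε1 : ε ≤ 1) :
    ∫ x in ε..1, fToy a x ^ 2 / gToy b x = a ^ 2 / (b * (2 * a - b)) * (1 - ε ^ (2 * a - b)) := by
  have hcongr : ∫ x in ε..1, fToy a x ^ 2 / gToy b x = ∫ x in ε..1, a ^ 2 / b * x ^ (2 * a - b - 1) := by
    apply intervalIntegral.integral_congr_ae
    filter_upwards with x hx
    rw [Set.uIoc_of_le hε1] at hx
    exact sq_div_toy_eq a b x (hε.trans hx.1) hb.ne'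
  have h0 : (0:ℝ) ∉ Set.uIcc ε 1 := by
    rw [Set.uIcc_of_le hε1]
    intro h
    exact absurd h.1 (not_le.mpr hε)
  have hne : 2 * a - b ≠ 0 := by
    intro h; apply h2; linarith
  have hr : 2 * a - b - 1 ≠ -1 := by
    intro h; apply hne; linarith
  rw [hcongr, intervalIntegral.integral_const_mul, integral_rpow (Or.inr ⟨hr, h0⟩)]
  have h2' : 2 * a - b - 1 + 1 = 2 * a - b := by ring
  rw [h2', Real.one_rpow]
  field_simp

/-- The exponent identity behind the lane's `g_implied = 1/α − 1/2`: with `α = b/(b−a)`, `(b − 2a)/b = 2/α − 1`.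
(⟦lit⟧: so the truncated second moment's growth `ε^{−(b−2a)}` at depth `ε = N^{−1/b}` is `N^{2/α−1}` — `depthCut_rpow`; taking its square
root as `σ·√N ∝ N^{1/α − 1/2}` is the cell's heuristic reading, not proved here.) [cite: Volkov2017, §III.A (eq_ab_disp)] -/
theorem growthExponent_eq {a b : ℝ} (ha : 0 < a) (hab : a < b) : (b - 2 * a) / b = 2 / (b / (b - a)) - 1 := by
  have hb : b ≠ 0 := by linarith
  have hc : b - a ≠ 0 := by linarith
  field_simp
  ring

/-- `(N^{−1/b})^{−(b−2a)} = N^{2/α − 1}` for `N > 0` (case `b > a`). Elementary. [cite: Volkov2017, §III.A (eq_ab_disp)] -/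
theorem depthCut_rpow {a b : ℝ} (ha : 0 < a) (hab : a < b) (N : ℝ) (hN : 0 < N) :
    (N ^ (-1 / b)) ^ (-(b - 2 * a)) = N ^ (2 / (b / (b - a)) - 1) := by
  rw [← Real.rpow_mul hN.le, ← growthExponent_eq ha hab]
  congr 1
  have hb : b ≠ 0 := by linarith
  field_simp

end

end Literature.MathematicalPhysics.QuantumFieldTheory.Volkov2017
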